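import Summits.ABC.ABC.Theses.PadicPrimesYuNinety
import Summits.ABC.ABC.Theorems.PadicPrimesYuNinetyRung
import Summits.ABC.StewartYu.PrincipalUnitLatticeArith
import Literature.Barriers.ABC.BakerMethodBoundsStewartTijdemanGenericProofs
import HarnessLib

set_option linter.dupNamespace false

/-!
# Route PadicPrimesYuNinety, crux `YuNinetyTwo` (`p = 2`): the TRANSFER stub (engine ⇒ crux)

`Summits/ABC/ABC/Theorems/PadicPrimesYuNinetyTwoTransfer.lean` — cell `abc-stewartyu`, seat p1. The
birth skeleton of crux stmt-ABC-19251 (line `two-adic-cubic-descent`, planner g3) has two stubs: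
`stub_engineTwo : TwoAdicPrincipalCubic` (XL: the `2`-adic Theorem A under a CUBE-Kummer condition,
`q = 3` descent) and `stub_transferTwo : TwoAdicPrincipalCubic → YuNinetyTwo` (M, bookkeeping). This
file proves the transfer with the engine statement as the explicit hypothesis `hE` (its body, verbatim),
so the lead's `stub_transferTwo` is `fun h => padicPrimesYuNinety_two_of_engine h` once
`TwoAdicPrincipalCubic` is an importable decl; it CONFIRMS that the engine clothing
(`ord₂(∏ αⱼ^{bⱼ} − 1) ≤ C(m) · ∏ Vⱼ · W · (1 + log Vmax)`, `C(m) ≤ c₁^m m^m`) suffices for the crux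
text with `c₅ = 5c₁`.

Bookkeeping (the planner's recipe): enumerate `S` (odd primes, `m = #S ≥ 1`), `αⱼ = qⱼ²`
(`qⱼ` odd ⇒ `8 ∣ qⱼ² − 1`, Mathlib `Nat.eight_dvd_sq_sub_one_of_odd`, so `ord₂(αⱼ − 1) ≥ 3`),
`bⱼ = e(qⱼ)`; squares of distinct primes are multiplicatively independent and CUBE-Kummer
(`ord_{qⱼ}` of a cube is `≡ 0 (mod 3)`, of `∏ q_k^{2μ_k}` it is `2μⱼ`); `Vⱼ = 2 log (max 4 qⱼ)`,
`Vmax = 2 log (max 4 (sup S))`, `W = log B`; `ord₂(u − 1) ≤ ord₂(u² − 1)` (`ord₂(u + 1) ≥ 0` for the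
`2`-adic unit `u = ∏ q^{e_q}`); `1 + log Vmax ≤ 8 log log (max 4 (sup S))`; `8 · 2^m < 4 · 5^m`.
Everything is [folklore].
-/

noncomputable section

open Finset Real Height

namespace Summit.ABC.ABC.Theorems

/-- `log (max 4 n) ≥ 1.38` (`log 4 = 2 log 2 > 1.386`). [folklore] -/
theorem log_max_four_ge (n : ℕ) : (1.38 : ℝ) ≤ Real.log ((max 4 n : ℕ) : ℝ) := by
  have h4 : (4 : ℝ) ≤ ((max 4 n : ℕ) : ℝ) := by exact_mod_cast le_max_left 4 n
  have h2 : (1.38 : ℝ) ≤ Real.log 4 := by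
    have := Real.log_two_gt_d9
    have h : Real.log 4 = 2 * Real.log 2 := by
      rw [show (4 : ℝ) = 2 ^ 2 by norm_num, Real.log_pow]; norm_num
    linarith
  exact h2.trans (Real.log_le_log (by norm_num) h4)

/-- `ord₂(q² − 1) ≥ 3` for an odd prime `q` (`8 ∣ q² − 1`). [folklore] -/
theorem three_le_padicValRat_sq_sub_one {q : ℕ} (hq : q.Prime) (hq2 : q ≠ 2) :
    3 ≤ padicValRat 2 ((q : ℚ) ^ 2 - 1) := by
  have hodd : Odd q := hq.odd_of_ne_two hq2
  have h8 : 8 ∣ q ^ 2 - 1 := Nat.eight_dvd_sq_sub_one_of_odd hodd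
  have hq1 : 1 ≤ q ^ 2 := Nat.one_le_pow _ _ hq.pos
  have hne : q ^ 2 - 1 ≠ 0 := by
    have : 2 ≤ q := hq.two_le
    have : 4 ≤ q ^ 2 := by nlinarith
    omega
  have hcast : ((q : ℚ) ^ 2 - 1) = ((q ^ 2 - 1 : ℕ) : ℚ) := by
    rw [Nat.cast_sub hq1]; push_cast; ring
  rw [hcast, padicValRat.of_nat]
  have h3 : 3 ≤ padicValNat 2 (q ^ 2 - 1) :=
    (padicValNat_dvd_iff_le hne).mp (by norm_num; exact h8)
  exact_mod_cast h3

/-- Squares of distinct primes are CUBE-Kummer-free: if some exponent `μⱼ` is not divisible by `3`,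
then `∏ (q_k²)^{μ_k}` is not a cube in `ℚ` (`ord_{qⱼ} = 2μⱼ ≢ 0 (mod 3)`). [folklore] -/
theorem not_cube_prod_sq_primes {m : ℕ} (q : Fin m → ℕ) (hq : ∀ i, (q i).Prime)
    (hinj : Function.Injective q) (μ : Fin m → ℕ) (hμ : ∃ j, ¬ 3 ∣ μ j) (y : ℚ) :
    y ^ 3 ≠ ∏ k, ((q k : ℚ) ^ 2) ^ μ k := by
  classical
  obtain ⟨j, hj⟩ := hμ
  intro hy
  haveI : Fact (q j).Prime := ⟨hq j⟩
  have hq0 : ∀ k, (q k : ℚ) ≠ 0 := fun k => by exact_mod_cast (hq k).ne_zero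
  have hprod : padicValRat (q j) (∏ k, ((q k : ℚ) ^ 2) ^ μ k) = 2 * μ j := by
    rw [Summit.ABC.StewartYu.PrincipalLattice.padicValRat_finset_prod _ _
      fun k _ => pow_ne_zero _ (pow_ne_zero _ (hq0 k)), Finset.sum_eq_single j]
    · rw [padicValRat.pow, padicValRat.pow, padicValRat.of_nat, padicValNat_self]
      push_cast; ring
    · intro k _ hk
      haveI : Fact (q k).Prime := ⟨hq k⟩
      rw [padicValRat.pow, padicValRat.pow, padicValRat.of_nat,
        padicValNat_primes (fun h => hk (hinj h).symm)]
      simp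
    · intro h; exact absurd (Finset.mem_univ j) h
  have hy0 : y ≠ 0 := by
    intro h0
    rw [h0, zero_pow three_ne_zero] at hy
    exact (Finset.prod_ne_zero_iff.mpr fun k _ => pow_ne_zero _ (pow_ne_zero _ (hq0 k))) hy.symm
  have hval : padicValRat (q j) (y ^ 3) = 3 * padicValRat (q j) y := by
    rw [padicValRat.pow]; push_cast; ring
  rw [hy, hprod] at hval
  -- `2 μ j = 3 v`: then `3 ∣ μ j`
  apply hj
  have h3 : (3 : ℤ) ∣ 2 * (μ j : ℤ) := ⟨padicValRat (q j) y, by exact_mod_cast hval⟩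
  have h3' : (3 : ℤ) ∣ (μ j : ℤ) := by
    have hco : IsCoprime (3 : ℤ) 2 := by norm_num
    exact hco.dvd_of_dvd_mul_left h3
  exact_mod_cast h3'

/-- **Transfer `TwoAdicPrincipalCubic ⇒ YuNinetyTwo`** (the M-sized stub of the birth skeleton of crux
stmt-ABC-19251, with the engine statement as the explicit hypothesis `hE`, verbatim): a `2`-adic
Theorem A for principal units `αⱼ ≡ 1 (mod 8)` under a cube-Kummer condition, with
`ord₂(∏ αⱼ^{bⱼ} − 1) ≤ C(m)·∏Vⱼ·W·(1 + log Vmax)`, `C(m) ≤ c₁^m m^m`, gives the crux text with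
`c₅ = 5c₁` via `αⱼ = qⱼ²`. [folklore] -/
theorem padicPrimesYuNinety_two_of_engine
    (hE : ∃ (C : ℕ → ℝ) (c₁ : ℝ), 1 ≤ c₁ ∧ (∀ m, 0 ≤ C m ∧ C m ≤ c₁ ^ m * (m : ℝ) ^ m) ∧
      ∀ (m : ℕ) (α : Fin m → ℚ) (b : Fin m → ℤ) (V : Fin m → ℝ) (Vmax W : ℝ),
        (∀ j, α j ≠ 0 ∧ 3 ≤ padicValRat 2 (α j - 1)) →
        (∀ μ : Fin m → ℤ, ∏ j, α j ^ μ j = 1 → μ = 0) →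
        (∀ μ : Fin m → ℕ, (∃ j, ¬ 3 ∣ μ j) → ∀ y : ℚ, y ^ 3 ≠ ∏ j, α j ^ μ j) →
        (∀ j, Height.logHeight₁ (α j) ≤ V j) → (∀ j, Real.log 2 ≤ V j) → (∀ j, V j ≤ Vmax) →
        b ≠ 0 → (∀ j, Real.log (max 3 (|b j| : ℝ)) ≤ W) →
        (padicValRat 2 (∏ j, α j ^ b j - 1) : ℝ) ≤ C m * (∏ j, V j) * W * (1 + Real.log Vmax)) :
    Summit.ABC.ABC.Theses.PadicPrimesYuNinety.YuNinetyTwo := by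
  classical
  obtain ⟨C, c₁, hc₁, hC, hA⟩ := hE
  refine ⟨5 * c₁, ?_⟩
  intro S hS h2S hSne e B hB heB hne1
  haveI : Fact (Nat.Prime 2) := ⟨Nat.prime_two⟩
  -- enumeration of `S`
  set m : ℕ := S.card with hm
  have hm1 : 1 ≤ m := Finset.card_pos.mpr hSne
  set φ : Fin m ≃ S := S.equivFin.symm with hφ
  set q : Fin m → ℕ := fun i => (φ i : ℕ) with hqdef
  have hqS : ∀ i, q i ∈ S := fun i => (φ i).2
  have hqP : ∀ i, (q i).Prime := fun i => hS _ (hqS i)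
  have hinj : Function.Injective q := fun i j hij => φ.injective (Subtype.ext hij)
  have hq2 : ∀ i, q i ≠ 2 := fun i h => h2S (h ▸ hqS i)
  have hq0 : ∀ k, (q k : ℚ) ≠ 0 := fun k => by exact_mod_cast (hqP k).ne_zero
  have hreidx : ∀ {M : Type} [CommMonoid M] (f : ℕ → M), ∏ i, f (q i) = ∏ x ∈ S, f x := by
    intro M _ f
    rw [← Finset.prod_coe_sort S f]
    exact Fintype.prod_equiv φ (fun i => f (q i)) (fun x => f x) (fun i => rfl)
  -- the data fed to the engine
  set M4 : ℝ := ((max 4 (S.sup id) : ℕ) : ℝ) with hM4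
  set X : ℝ := Real.log M4 with hX
  set α : Fin m → ℚ := fun j => (q j : ℚ) ^ 2 with hα
  set b : Fin m → ℤ := fun j => e (q j) with hb
  set V : Fin m → ℝ := fun j => 2 * Real.log ((max 4 (q j) : ℕ) : ℝ) with hV
  set Vmax : ℝ := 2 * X with hVmax
  set W : ℝ := Real.log B with hW
  have hL2 : Real.log 2 < 0.6931471808 := Real.log_two_lt_d9
  have hL2' : 0.6931471803 < Real.log 2 := Real.log_two_gt_d9
  have hX1 : (1.38 : ℝ) ≤ X := log_max_four_ge (S.sup id)
  have hℓ : (0.27 : ℝ) ≤ Real.log X := PadicPrimesYuNinetyRung.loglog_max_four_ge (S.sup id)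
  have hX0 : 0 < X := by linarith
  have hlogmax : ∀ j, (1.38 : ℝ) ≤ Real.log ((max 4 (q j) : ℕ) : ℝ) := fun j =>
    log_max_four_ge (q j)
  -- the engine's hypotheses
  have h1 : ∀ j, α j ≠ 0 ∧ 3 ≤ padicValRat 2 (α j - 1) := fun j =>
    ⟨pow_ne_zero _ (hq0 j), three_le_padicValRat_sq_sub_one (hqP j) (hq2 j)⟩
  have h2 : ∀ μ : Fin m → ℤ, ∏ j, α j ^ μ j = 1 → μ = 0 := by
    intro μ hμ
    have hμ' : ∏ j, (q j : ℚ) ^ ((2 : ℤ) * μ j) = 1 := by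
      rw [← hμ]
      refine Finset.prod_congr rfl fun j _ => ?_
      simp only [hα]
      rw [zpow_mul]; norm_cast
    have h0 := Literature.Barriers.ABC.StewartTijdemanGeneric.prime_family_zpow_eq_one hqP hinj hμ'
    funext j
    have := congrFun h0 j
    simp only [Pi.zero_apply, mul_eq_zero, OfNat.ofNat_ne_zero, false_or] at this
    exact this
  have h3 : ∀ μ : Fin m → ℕ, (∃ j, ¬ 3 ∣ μ j) → ∀ y : ℚ, y ^ 3 ≠ ∏ j, α j ^ μ j :=
    fun μ hμ y => not_cube_prod_sq_primes q hqP hinj μ hμ y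
  have h4 : ∀ j, logHeight₁ (α j) ≤ V j := by
    intro j
    haveI : NeZero (q j ^ 2) := ⟨pow_ne_zero _ (hqP j).ne_zero⟩
    have hh : logHeight₁ (α j) = 2 * Real.log (q j) := by
      have : α j = ((q j ^ 2 : ℕ) : ℚ) := by simp only [hα]; push_cast; ring
      rw [this, Rat.logHeight₁_natCast (q j ^ 2)]
      push_cast
      rw [Real.log_pow]; norm_num
    rw [hh]
    have hq4 : Real.log (q j) ≤ Real.log ((max 4 (q j) : ℕ) : ℝ) :=
      Real.log_le_log (by exact_mod_cast (hqP j).pos) (by exact_mod_cast le_max_right 4 (q j))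
    show 2 * Real.log (q j) ≤ 2 * Real.log ((max 4 (q j) : ℕ) : ℝ)
    linarith
  have h5 : ∀ j, Real.log 2 ≤ V j := fun j => by
    show Real.log 2 ≤ 2 * Real.log ((max 4 (q j) : ℕ) : ℝ)
    linarith [hlogmax j]
  have h6 : ∀ j, V j ≤ Vmax := by
    intro j
    have hle : ((max 4 (q j) : ℕ) : ℝ) ≤ M4 := by
      rw [hM4]
      exact_mod_cast max_le_max le_rfl (Finset.le_sup (f := id) (hqS j))
    have hpos : (0 : ℝ) < ((max 4 (q j) : ℕ) : ℝ) := by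
      exact_mod_cast lt_of_lt_of_le (by norm_num) (le_max_left 4 (q j))
    show 2 * Real.log ((max 4 (q j) : ℕ) : ℝ) ≤ 2 * X
    linarith [Real.log_le_log hpos hle]
  -- `∏ αⱼ^{bⱼ} = u²`, `u = ∏_{q ∈ S} q^{e_q}`
  set u : ℚ := ∏ x ∈ S, (x : ℚ) ^ e x with hu
  have hprodQ : ∏ j, (q j : ℚ) ^ b j = u := hreidx (fun x => (x : ℚ) ^ e x)
  have hprodα : ∏ j, α j ^ b j = u ^ 2 := by
    rw [← hprodQ, ← Finset.prod_pow]
    refine Finset.prod_congr rfl fun j _ => ?_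
    simp only [hα]
    rw [← zpow_natCast, ← zpow_natCast, ← zpow_mul, ← zpow_mul, mul_comm]
  have h7 : b ≠ 0 := by
    intro h0
    apply hne1
    rw [← hprodQ]
    exact Finset.prod_eq_one fun j _ => by rw [show b j = 0 from congrFun h0 j, zpow_zero]
  have hB0 : 0 < Real.log B := Real.log_pos (by linarith)
  have h8 : ∀ j, Real.log (max 3 (|b j| : ℝ)) ≤ W := by
    intro j
    have hle : max 3 (|b j| : ℝ) ≤ B := max_le hB (by simp only [hb]; exact heB _ (hqS j))
    exact Real.log_le_log (lt_of_lt_of_le (by norm_num) (le_max_left _ _)) hle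
  -- the engine
  have key := hA m α b V Vmax W h1 h2 h3 h4 h5 h6 h7 h8
  rw [hprodα] at key
  -- `ord₂(u − 1) ≤ ord₂(u² − 1)`
  have hupos : 0 < u := Finset.prod_pos fun x hx => zpow_pos (by exact_mod_cast (hS x hx).pos) _
  have hu1 : u - 1 ≠ 0 := sub_ne_zero.mpr hne1
  have hu1' : u + 1 ≠ 0 := by linarith
  have hvu : padicValRat 2 u = 0 := by
    rw [hu, Summit.ABC.StewartYu.PrincipalLattice.padicValRat_finset_prod _ _
      fun x hx => zpow_ne_zero _ (by exact_mod_cast (hS x hx).ne_zero)]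
    refine Finset.sum_eq_zero fun x hx => ?_
    rw [padicValRat.zpow,
      Literature.Barriers.ABC.StewartTijdemanGeneric.padicValRat_natCast_prime_of_ne Nat.prime_two
        (hS x hx) (fun h => h2S (h ▸ hx))]
    simp
  have hvplus : 0 ≤ padicValRat 2 (u + 1) := by
    have h := padicValRat.min_le_padicValRat_add (p := 2) hu1'
    rw [hvu, padicValRat.one, min_self] at h
    exact h
  have hvsq : padicValRat 2 (u ^ 2 - 1) = padicValRat 2 (u - 1) + padicValRat 2 (u + 1) := by
    rw [show u ^ 2 - 1 = (u - 1) * (u + 1) by ring, padicValRat.mul hu1 hu1']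
  have hvle : (padicValRat 2 (u - 1) : ℝ) ≤ (padicValRat 2 (u ^ 2 - 1) : ℝ) := by
    rw [hvsq]; push_cast; linarith [(show (0 : ℝ) ≤ (padicValRat 2 (u + 1) : ℝ) by exact_mod_cast hvplus)]
  -- `∏ Vⱼ = 2^m · PL`
  set PL : ℝ := ∏ x ∈ S, Real.log ((max 4 x : ℕ) : ℝ) with hPL
  have hPV : ∏ j, V j = 2 ^ m * PL := by
    rw [hPL, ← hreidx (fun x => Real.log ((max 4 x : ℕ) : ℝ))]
    simp only [hV]
    rw [Finset.prod_mul_distrib, Finset.prod_const, Finset.card_univ, Fintype.card_fin]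
  have hPL0 : 0 < PL := Finset.prod_pos fun x _ => by
    linarith [log_max_four_ge x]
  have hW0 : 0 < W := hB0
  have hlX0 : 0 < Real.log X := by linarith
  -- the garbage `1 + log Vmax ≤ 8 log X`
  have hgarb : 1 + Real.log Vmax ≤ 8 * Real.log X := by
    rw [hVmax, Real.log_mul (by norm_num) hX0.ne']
    linarith
  -- assemble
  set v : ℝ := (padicValRat 2 (u - 1) : ℝ) with hv
  have hCm := hC m
  have hstep1 : v ≤ C m * (2 ^ m * PL) * W * (8 * Real.log X) := by
    have h0 : 0 ≤ C m * (2 ^ m * PL) * W :=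
      mul_nonneg (mul_nonneg hCm.1 (mul_nonneg (pow_nonneg (by norm_num) m) hPL0.le)) hW0.le
    calc v ≤ (padicValRat 2 (u ^ 2 - 1) : ℝ) := hvle
      _ ≤ C m * (∏ j, V j) * W * (1 + Real.log Vmax) := key
      _ = C m * (2 ^ m * PL) * W * (1 + Real.log Vmax) := by rw [hPV]
      _ ≤ C m * (2 ^ m * PL) * W * (8 * Real.log X) := mul_le_mul_of_nonneg_left hgarb h0
  have hA0 : 0 < W * Real.log X * PL := mul_pos (mul_pos hW0 hlX0) hPL0
  have hcm0 : 0 < c₁ ^ m * (m : ℝ) ^ m := by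
    have : (0 : ℝ) < m := by exact_mod_cast hm1
    positivity
  have h25 : (8 : ℝ) * 2 ^ m < 4 * 5 ^ m := by
    have h2 : (2 : ℝ) * 2 ^ m < 5 ^ m := by
      obtain ⟨k, hk⟩ : ∃ k, m = k + 1 := ⟨m - 1, by omega⟩
      rw [hk, pow_succ, pow_succ]
      have : (2 : ℝ) ^ k ≤ 5 ^ k := pow_le_pow_left₀ (by norm_num) (by norm_num) k
      nlinarith [pow_pos (show (0:ℝ) < 5 by norm_num) k]
    nlinarith
  calc v ≤ C m * (2 ^ m * PL) * W * (8 * Real.log X) := hstep1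
    _ ≤ (c₁ ^ m * (m : ℝ) ^ m) * (2 ^ m * PL) * W * (8 * Real.log X) := by
        have hr : 0 ≤ (2 ^ m * PL) * W * (8 * Real.log X) :=
          mul_nonneg (mul_nonneg (mul_nonneg (pow_nonneg (by norm_num) m) hPL0.le) hW0.le) (by linarith)
        calc C m * (2 ^ m * PL) * W * (8 * Real.log X) = C m * ((2 ^ m * PL) * W * (8 * Real.log X)) := by
              ring
          _ ≤ (c₁ ^ m * (m : ℝ) ^ m) * ((2 ^ m * PL) * W * (8 * Real.log X)) :=
              mul_le_mul_of_nonneg_right hCm.2 hr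
          _ = _ := by ring
    _ = (8 * 2 ^ m) * ((c₁ ^ m * (m : ℝ) ^ m) * (W * Real.log X * PL)) := by ring
    _ < (4 * 5 ^ m) * ((c₁ ^ m * (m : ℝ) ^ m) * (W * Real.log X * PL)) :=
        mul_lt_mul_of_pos_right h25 (mul_pos hcm0 hA0)
    _ = (5 * c₁ * m) ^ m * (2 : ℝ) ^ 2 * W * Real.log X * PL := by
        rw [mul_pow, mul_pow]; ring

end Summit.ABC.ABC.Theorems

end
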